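import Summits.CriticalPhenomena.PercolationContinuityZ3.Theorems.SahiMasterFamilyFourStep
import Summits.CriticalPhenomena.PercolationContinuityZ3.Theorems.SahiMasterFamilyLowerTransfer

/-!
# The order-four step for DECREASING events and for group separations

Unit `prim-master-conj` (crux anchor stmt-CriticalPhenomena-4575); companion of `SahiMasterFamilyFourStep.lean` (increasing
events) and `SahiMasterFamilyLowerTransfer.lean` (complementation transfer `E_k(μ_p; 1_D) = E_k(μ_{1−p}; 1_{compl⁻¹ D})`,
invariance of the zero-flag class under `compl⁻¹`).  The percolation rows of the one-cut programme are stated on group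
SEPARATIONS `{X ↮ Y}`, which are decreasing events, and the exact censuses of `E_4` on separation quadruples
(run/shared/lean/ttrl/e4, zero-flag acceptance FINAL 2026-08-20: every exact zero is a `Z_4` instance) are in this form.
PROVED here, unconditionally:
* `sahiE_four_ind_nonneg_of_zeroFlagTriple_lower` — for four DECREASING events three of which form a zero flag of order
  `3`, `E_4(μ_p; 1_{D_0},…,1_{D_3}) ≥ 0` for every `p ∈ [0,1]^ι`;
* `sahiE_four_ind_eq_zero_iff_of_zeroFlagTriple_lower` — for `p` in the open cube, `E_4 = 0 ↔ D ∈ Z_4` on such quadruples;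
* `sahiE_four_groupSep_nonneg_of_zeroFlagTriple`, `sahiE_four_groupSep_eq_zero_iff_of_zeroFlagTriple` — the same for four
  group separations of a finite weighted graph (zero-flag class computed on the edge cube).
[this work]
-/

noncomputable section

set_option autoImplicit false

open scoped Classical
open scoped unitInterval

namespace Summit.CriticalPhenomena.PercolationContinuityZ3.Theorems

open Finset Function MeasureTheory
open Literature.Combinatorics.Sahi2008
open Literature.Probability.LatticeModels (isUpperSet_preimage_compl isLowerSet_preimage_compl)
open Literature.Probability.Percolation.DecisionTree (ind)

section Lower

variable {ι : Type} [Fintype ι]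

/-- **`E_4 ≥ 0` for four decreasing events with a `Z_3` sub-triple** (every `p ∈ [0,1]^ι`). [this work] -/
theorem sahiE_four_ind_nonneg_of_zeroFlagTriple_lower (p : ι → unitInterval) (D : Fin 4 → Set (Set ι))
    (hD : ∀ j, IsLowerSet (D j)) (m : Fin 4) (hZ : SuppZeroFlag 3 (fun j => D (m.succAbove j))) :
    0 ≤ sahiE (bernoulliWeight p) 4 (fun j => ind (D j)) := by
  rw [sahiE_ind_eq_sahiE_ind_preimage_compl]
  exact sahiE_four_ind_nonneg_of_zeroFlagTriple _ (fun j => compl ⁻¹' D j)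
    (fun j => isUpperSet_preimage_compl (hD j)) m
    ((suppZeroFlag_preimage_compl_iff 3 (fun j => D (m.succAbove j))).2 hZ)

/-- **(EQ-4) for four decreasing events with a `Z_3` sub-triple** (`p` in the open cube): `E_4 = 0 ↔ D ∈ Z_4`.
[this work] -/
theorem sahiE_four_ind_eq_zero_iff_of_zeroFlagTriple_lower (p : ι → unitInterval)
    (hp : ∀ e, (p e : ℝ) ∈ Set.Ioo (0 : ℝ) 1) (D : Fin 4 → Set (Set ι)) (hD : ∀ j, IsLowerSet (D j)) (m : Fin 4)
    (hZ : SuppZeroFlag 3 (fun j => D (m.succAbove j))) :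
    sahiE (bernoulliWeight p) 4 (fun j => ind (D j)) = 0 ↔ SuppZeroFlag 4 D := by
  rw [sahiE_ind_eq_sahiE_ind_preimage_compl, ← suppZeroFlag_preimage_compl_iff 4 D]
  exact sahiE_four_ind_eq_zero_iff_of_zeroFlagTriple _ ((symm_mem_Ioo_iff p).2 hp) (fun j => compl ⁻¹' D j)
    (fun j => isUpperSet_preimage_compl (hD j)) m
    ((suppZeroFlag_preimage_compl_iff 3 (fun j => D (m.succAbove j))).2 hZ)

end Lower

/-! ### The graph form: four group separations -/

section Graph

open Literature.Probability.Percolation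

variable {V : Type} [Fintype V]

/-- **`E_4 ≥ 0` for four group separations `{X_j ↮ Y_j}` three of which form a zero flag of order `3`** (any finite
graph, any edge weights in `[0,1]`). [this work] -/
theorem sahiE_four_groupSep_nonneg_of_zeroFlagTriple (w : Sym2 V → unitInterval) (X Y : Fin 4 → Set V) (m : Fin 4)
    (hZ : SuppZeroFlag 3 fun j =>
      {ω : BondConfig V | ∀ x ∈ X (m.succAbove j), ∀ y ∈ Y (m.succAbove j), ¬ (openGraph ω).Reachable x y}) :
    0 ≤ sahiE (bernoulliWeight w) 4
      (fun j => ind {ω : BondConfig V | ∀ x ∈ X j, ∀ y ∈ Y j, ¬ (openGraph ω).Reachable x y}) :=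
  sahiE_four_ind_nonneg_of_zeroFlagTriple_lower w
    (fun j => {ω : BondConfig V | ∀ x ∈ X j, ∀ y ∈ Y j, ¬ (openGraph ω).Reachable x y})
    (fun j => isLowerSet_groupSep (X j) (Y j)) m hZ

/-- **The equality face for four group separations with a `Z_3` sub-triple** (edge weights in the open cube):
`E_4({X_0 ↮ Y_0},…,{X_3 ↮ Y_3}) = 0 ↔` the quadruple lies in `Z_4` (computed on the edge cube). [this work] -/
theorem sahiE_four_groupSep_eq_zero_iff_of_zeroFlagTriple (w : Sym2 V → unitInterval)
    (hw : ∀ e, (w e : ℝ) ∈ Set.Ioo (0 : ℝ) 1) (X Y : Fin 4 → Set V) (m : Fin 4)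
    (hZ : SuppZeroFlag 3 fun j =>
      {ω : BondConfig V | ∀ x ∈ X (m.succAbove j), ∀ y ∈ Y (m.succAbove j), ¬ (openGraph ω).Reachable x y}) :
    sahiE (bernoulliWeight w) 4
        (fun j => ind {ω : BondConfig V | ∀ x ∈ X j, ∀ y ∈ Y j, ¬ (openGraph ω).Reachable x y}) = 0 ↔
      SuppZeroFlag 4 fun j => {ω : BondConfig V | ∀ x ∈ X j, ∀ y ∈ Y j, ¬ (openGraph ω).Reachable x y} :=
  sahiE_four_ind_eq_zero_iff_of_zeroFlagTriple_lower w hw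
    (fun j => {ω : BondConfig V | ∀ x ∈ X j, ∀ y ∈ Y j, ¬ (openGraph ω).Reachable x y})
    (fun j => isLowerSet_groupSep (X j) (Y j)) m hZ

end Graph

end Summit.CriticalPhenomena.PercolationContinuityZ3.Theorems
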